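import Literature.Analysis.FluidPDE.KNSSRegularity
import HarnessLib

/-!
# The maximum-principle step of KNSS's Theorem 5.2 on `ℝ⁵`

Analysis/FluidPDE support file (all results proved) on the decomposition path of the named fact
`Literature.Analysis.FluidPDE.KNSS2009_liouville_axisymmetric_no_swirl` (Koch–Nadirashvili–
Seregin–Šverák, *Liouville theorems for the Navier–Stokes equations and applications*, Acta
Math. 203 (2009) = arXiv:0709.3599, Theorem 5.2). The printed proof (p. 10, repeating p. 9):
"Let `M₁ = sup f` […] and assume that `M₁ > 0`. By Lemma 2.1 there exist arbitrarily large balls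
`Q_R = B(ȳ, R) × (t̄ − R², t̄)` such that `f ≥ M₁/2` in `Q_R`" — and this is incompatible with
`|ω_θ| = r |f| ≤ C` ("we get a contradiction […] if `R` is sufficiently large"); the same for
`−f`, so `f = ω_θ / r` vanishes identically.

This file isolates that step as a statement about the elementary solution class of the named
fact `KNSS2009_lemma21_halfball` (Lemma 2.1 in the form used in §5) on
`E = EuclideanSpace ℝ (Fin 5)`:

* `KNSS2009_lemma21_halfball.nonpos_of_abs_mul_le`: if `(f, a)` is in the class of the fact and
  `|y₀| |f(t, y)| ≤ K` (the obstruction furnished by the boundedness of the vorticity, `y₀` any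
  fixed coordinate of the `SO(4)`-variables, `|y₀| ≤ r`), then `f ≤ 0`: otherwise `M₁ = sup f > 0`,
  the fact gives half-balls of radius `R > 4K/M₁` on which `f ≥ M₁/2`, and such a ball contains
  points with `|y₀| ≥ R/2`;
* `KNSS2009_lemma21_halfball.eq_zero_of_abs_mul_le`: applying this to `f` and `−f`, `f = 0`.

## References

* G. Koch, N. Nadirashvili, G. Seregin, V. Šverák, *Liouville theorems for the Navier–Stokes
  equations and applications*, Acta Math. 203 (2009) = arXiv:0709.3599, proof of Theorem 5.1
  (p. 9) and of Theorem 5.2 (p. 10); Lemma 2.1 (p. 5). [KochNadirashviliSereginSverak2009]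
-/

noncomputable section

open Set Function Filter MeasureTheory Topology InnerProductSpace
open scoped Laplacian ContDiff

namespace Literature.Analysis.FluidPDE

namespace KNSS2009_lemma21_halfball

/-- **`sup f ≤ 0` from Lemma 2.1 and the obstruction `|y₀| |f| ≤ K`** (KNSS 2009, proof of
Theorem 5.2, p. 10, with p. 9: "By Lemma 2.1 there exist arbitrarily large balls
`Q_R = B(ȳ, R) × (t̄ − R², t̄)` such that `f ≥ M₁/2` in `Q_R` […] we get a contradiction if `R` is
sufficiently large"). For `(f, a)` in the solution class of `KNSS2009_lemma21_halfball` on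
`EuclideanSpace ℝ (Fin 5)` with `|y 0| · |f(t, y)| ≤ K` for all `t < 0`, `y`, one has `f ≤ 0`.
[cite: KochNadirashviliSereginSverak2009, proof of Thm 5.2 (arXiv p. 10) with proof of Thm 5.1 (p. 9)] -/
theorem nonpos_of_abs_mul_le (hball : KNSS2009_lemma21_halfball (EuclideanSpace ℝ (Fin 5)))
    {f : ℝ → EuclideanSpace ℝ (Fin 5) → ℝ}
    {a : ℝ → EuclideanSpace ℝ (Fin 5) → EuclideanSpace ℝ (Fin 5)} {A K : ℝ}
    (ha : Measurable (uncurry a)) (haA : ∀ t < 0, ∀ y, ‖a t y‖ ≤ A)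
    (hfb : ∃ C : ℝ, ∀ t < 0, ∀ y, |f t y| ≤ C) (hf2 : ∀ t < 0, ContDiff ℝ 2 (f t))
    (hfD : ∃ C : ℝ, ∀ t < 0, ∀ y, ‖fderiv ℝ (f t) y‖ ≤ C ∧ |(Δ (f t)) y| ≤ C)
    (hcD : ContinuousOn (fun p : ℝ × EuclideanSpace ℝ (Fin 5) => fderiv ℝ (f p.1) p.2) (Iio 0 ×ˢ univ))
    (hcΔ : ContinuousOn (fun p : ℝ × EuclideanSpace ℝ (Fin 5) => (Δ (f p.1)) p.2) (Iio 0 ×ˢ univ))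
    (heq : ∀ y, ∀ s t : ℝ, s ≤ t → t < 0 →
      f t y - f s y = ∫ τ in s..t, ((Δ (f τ)) y - fderiv ℝ (f τ) y (a τ y)))
    (hK : ∀ t < 0, ∀ y, |y 0| * |f t y| ≤ K) :
    ∀ t < 0, ∀ y, f t y ≤ 0 := by
  by_contra hcon
  push Not at hcon
  obtain ⟨t₁, ht₁, y₁, hpos⟩ := hcon
  obtain ⟨C, hC⟩ := hfb
  -- `M₁ = sup f`
  set S : Set ℝ := {r | ∃ t < 0, ∃ y, f t y = r} with hS_def
  have hSb : BddAbove S := ⟨C, fun r ⟨t, ht, y, hr⟩ => hr ▸ (le_abs_self _).trans (hC t ht y)⟩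
  have hSne : S.Nonempty := ⟨f t₁ y₁, t₁, ht₁, y₁, rfl⟩
  set M₁ : ℝ := sSup S with hM₁_def
  have hle : ∀ t < 0, ∀ y, f t y ≤ M₁ := fun t ht y => le_csSup hSb ⟨t, ht, y, rfl⟩
  have hM₁pos : 0 < M₁ := hpos.trans_le (hle t₁ ht₁ y₁)
  have happr : ∀ ε > 0, ∃ t < 0, ∃ y, M₁ - ε < f t y := fun ε hε => by
    obtain ⟨r, ⟨t, ht, y, rfl⟩, hr⟩ := exists_lt_of_lt_csSup hSne (by linarith : M₁ - ε < M₁)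
    exact ⟨t, ht, y, hr⟩
  -- `K ≥ 0`
  have hK0 : 0 ≤ K := le_trans (mul_nonneg (abs_nonneg _) (abs_nonneg _)) (hK t₁ ht₁ y₁)
  -- a half-ball of radius `R > 4K / M₁`
  set R : ℝ := 4 * K / M₁ + 1 with hR_def
  have hRpos : 0 < R := by positivity
  have hRK : K < R * M₁ / 4 := by
    rw [hR_def]
    have : (4 * K / M₁ + 1) * M₁ / 4 = K + M₁ / 4 := by field_simp
    rw [this]
    linarith
  obtain ⟨y₀, t₀, ht₀, hhalf⟩ :=
    hball ha haA ⟨C, hC⟩ hf2 hfD hcD hcΔ heq hle happr hM₁pos R hRpos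
  -- a point of the ball with `|y 0| ≥ R / 2`, at a time of the window
  set σ : ℝ := if 0 ≤ y₀ 0 then 1 else -1 with hσ_def
  have hσ : |σ| = 1 := by rw [hσ_def]; split_ifs <;> simp
  set y : EuclideanSpace ℝ (Fin 5) := y₀ + (σ * (R / 2)) • EuclideanSpace.single 0 (1 : ℝ) with hy_def
  have hyball : y ∈ Metric.ball y₀ R := by
    rw [Metric.mem_ball, dist_eq_norm, hy_def, add_sub_cancel_left, norm_smul, PiLp.norm_single,
      norm_one, mul_one, Real.norm_eq_abs, abs_mul, hσ, one_mul, abs_of_pos (by positivity : 0 < R / 2)]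
    linarith
  have hy0 : R / 2 ≤ |y 0| := by
    have : y 0 = y₀ 0 + σ * (R / 2) := by
      rw [hy_def, PiLp.add_apply, PiLp.smul_apply, PiLp.single_apply, if_pos rfl, smul_eq_mul, mul_one]
    rw [this, hσ_def]
    split_ifs with h
    · rw [abs_of_nonneg (by positivity)]; linarith
    · push Not at h
      rw [abs_of_neg (by linarith)]; linarith
  set t : ℝ := t₀ - R ^ 2 / 2 with ht_def
  have htI : t ∈ Ioo (t₀ - R ^ 2) t₀ := by
    constructor <;> · rw [ht_def]; nlinarith
  have ht : t < 0 := htI.2.trans ht₀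
  have hft : M₁ / 2 ≤ f t y := hhalf t htI y hyball
  -- contradiction with the obstruction
  have h1 : R / 2 * (M₁ / 2) ≤ |y 0| * |f t y| :=
    mul_le_mul hy0 (hft.trans (le_abs_self _)) (by positivity) (abs_nonneg _)
  have h2 := hK t ht y
  nlinarith

/-- **`f = 0` from Lemma 2.1 and the obstruction** (KNSS 2009, proof of Theorem 5.2, p. 10:
"Applying Lemma 2.1 in the same way as [for Theorem 5.1], we see that `f ≤ 0`, and similarly
`f ≥ 0`. Hence `ω_θ` vanishes identically"): under the hypotheses of `nonpos_of_abs_mul_le`,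
`f(t, y) = 0` for all `t < 0` and `y` (apply it to `f` and to `−f`, which is in the same class
with the same drift). [cite: KochNadirashviliSereginSverak2009, proof of Thm 5.2 (arXiv p. 10)] -/
theorem eq_zero_of_abs_mul_le (hball : KNSS2009_lemma21_halfball (EuclideanSpace ℝ (Fin 5)))
    {f : ℝ → EuclideanSpace ℝ (Fin 5) → ℝ}
    {a : ℝ → EuclideanSpace ℝ (Fin 5) → EuclideanSpace ℝ (Fin 5)} {A K : ℝ}
    (ha : Measurable (uncurry a)) (haA : ∀ t < 0, ∀ y, ‖a t y‖ ≤ A)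
    (hfb : ∃ C : ℝ, ∀ t < 0, ∀ y, |f t y| ≤ C) (hf2 : ∀ t < 0, ContDiff ℝ 2 (f t))
    (hfD : ∃ C : ℝ, ∀ t < 0, ∀ y, ‖fderiv ℝ (f t) y‖ ≤ C ∧ |(Δ (f t)) y| ≤ C)
    (hcD : ContinuousOn (fun p : ℝ × EuclideanSpace ℝ (Fin 5) => fderiv ℝ (f p.1) p.2) (Iio 0 ×ˢ univ))
    (hcΔ : ContinuousOn (fun p : ℝ × EuclideanSpace ℝ (Fin 5) => (Δ (f p.1)) p.2) (Iio 0 ×ˢ univ))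
    (heq : ∀ y, ∀ s t : ℝ, s ≤ t → t < 0 →
      f t y - f s y = ∫ τ in s..t, ((Δ (f τ)) y - fderiv ℝ (f τ) y (a τ y)))
    (hK : ∀ t < 0, ∀ y, |y 0| * |f t y| ≤ K) :
    ∀ t < 0, ∀ y, f t y = 0 := by
  have hup := nonpos_of_abs_mul_le hball ha haA hfb hf2 hfD hcD hcΔ heq hK
  -- the class is symmetric under `f ↦ −f`
  set g : ℝ → EuclideanSpace ℝ (Fin 5) → ℝ := fun t y => -f t y with hg_def
  have hg_slice : ∀ t, g t = -f t := fun t => rfl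
  obtain ⟨C, hC⟩ := hfb
  obtain ⟨C', hC'⟩ := hfD
  have hgb : ∃ C : ℝ, ∀ t < 0, ∀ y, |g t y| ≤ C := ⟨C, fun t ht y => by rw [hg_def, abs_neg]; exact hC t ht y⟩
  have hg2 : ∀ t < 0, ContDiff ℝ 2 (g t) := fun t ht => by rw [hg_slice]; exact (hf2 t ht).neg
  have hgfd : ∀ t y, fderiv ℝ (g t) y = -fderiv ℝ (f t) y := fun t y => by
    rw [hg_slice, fderiv_neg]
  have hgΔ : ∀ t y, (Δ (g t)) y = -(Δ (f t)) y := fun t y => by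
    rw [hg_slice, laplacian_neg, Pi.neg_apply]
  have hgD : ∃ C : ℝ, ∀ t < 0, ∀ y, ‖fderiv ℝ (g t) y‖ ≤ C ∧ |(Δ (g t)) y| ≤ C :=
    ⟨C', fun t ht y => by rw [hgfd, hgΔ, norm_neg, abs_neg]; exact hC' t ht y⟩
  have hgcD : ContinuousOn (fun p : ℝ × EuclideanSpace ℝ (Fin 5) => fderiv ℝ (g p.1) p.2)
      (Iio 0 ×ˢ univ) := by
    have : (fun p : ℝ × EuclideanSpace ℝ (Fin 5) => fderiv ℝ (g p.1) p.2) =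
        fun p => -fderiv ℝ (f p.1) p.2 := funext fun p => hgfd p.1 p.2
    rw [this]; exact hcD.neg
  have hgcΔ : ContinuousOn (fun p : ℝ × EuclideanSpace ℝ (Fin 5) => (Δ (g p.1)) p.2)
      (Iio 0 ×ˢ univ) := by
    have : (fun p : ℝ × EuclideanSpace ℝ (Fin 5) => (Δ (g p.1)) p.2) = fun p => -(Δ (f p.1)) p.2 :=
      funext fun p => hgΔ p.1 p.2
    rw [this]; exact hcΔ.neg
  have hgeq : ∀ y, ∀ s t : ℝ, s ≤ t → t < 0 →
      g t y - g s y = ∫ τ in s..t, ((Δ (g τ)) y - fderiv ℝ (g τ) y (a τ y)) := by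
    intro y s t hst ht
    have h1 : (fun τ => (Δ (g τ)) y - fderiv ℝ (g τ) y (a τ y)) =
        fun τ => -((Δ (f τ)) y - fderiv ℝ (f τ) y (a τ y)) := by
      funext τ; rw [hgΔ, hgfd, _root_.neg_apply]; ring
    rw [h1, intervalIntegral.integral_neg, ← heq y s t hst ht, hg_def]
    ring
  have hgK : ∀ t < 0, ∀ y, |y 0| * |g t y| ≤ K := fun t ht y => by
    rw [hg_def, abs_neg]; exact hK t ht y
  have hdown := nonpos_of_abs_mul_le hball ha haA hgb hg2 hgD hgcD hgcΔ hgeq hgK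
  intro t ht y
  have h1 := hup t ht y
  have h2 := hdown t ht y
  rw [hg_def] at h2
  linarith

end KNSS2009_lemma21_halfball

end Literature.Analysis.FluidPDE

end
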